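import Literature.AlgebraicGeometry.Motives.MumfordTateGroupOfOrientationComplexPoints
import HarnessLib

/-!
# The Hodge group of `V^n_{(F,Π)}` on `ℂ`-points: `Hg(V^n_{(F,Π)})(ℂ)` is the subtorus of `Res_{F/ℚ}𝔾_m(ℂ) = (ℂ^×)^{Hom(F,ℂ)}`
# cut out by the ORIENTATION-BALANCED characters `c` (`2 Σ_σ c_σ deg(τ•σ) = n Σ_σ c_σ` for all `τ ∈ Aut(ℂ)`);
# rational points; for a CM field `Hg(V^n_{(F,Π)})(ℂ) ⊆ U_F(ℂ) = {u | u_σ u_σ̄ = 1}`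

[topic AlgebraicGeometry/Motives]

Layer `Literature/AlgebraicGeometry/Motives`, lane `lit-hodgefound` (Track 2 foundations library; seat `lit-hodgefound-p02`, gen 26,
row g26-#2 FILE 2).  THEOREMS ONLY (no definition, no named fact; net debt `0`).  The HIGHER-WEIGHT twin of Part II
(§6–§10) of p29's weight-one `Motives/MumfordTateGroupOfCMTypeComplexPoints`, followed LINE BY LINE with `𝟙_Φ` replaced by
the degree function `deg_Π` of an `n`-orientation and Pohlmann's condition `2 Σ_σ c_σ [τσ ∈ Φ] = Σ_σ c_σ` by its weight-`n`
form `2 Σ_σ c_σ deg(τ•σ) = n · Σ_σ c_σ`; sequel BY NAME of FILE 1 `Motives/MumfordTateGroupOfOrientationComplexPoints`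
(Part I: `MT(V^n_{(F,Π)})(ℂ) = T_Π(ℂ)`), of p29's `Motives/MumfordTateGroupOfOrientationPoints`
(`hodgeGroupBaseChange_ofOrientation_apply`, `hodgeGroup_ofOrientation_apply`), of `Motives/ExtendedMumfordTateGroup`
(`mem_hodgeClasses_of_mem_span_degree`), `Motives/ZarhinHodgeGroupTypePP` (`tensorSpaceToBaseChange_mem_span_degree_eq`),
`Motives/HodgeStructureExteriorPowerHodgeGroup` (`mem_hodgeGroup_iff_glBaseChange_mem`).

THE PRINTS.  M. Green, P. Griffiths, M. Kerr, *Mumford–Tate Groups and Domains* [GreenGriffithsKerr2012] §I.B (I.B.1) (held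
p. 36): «`M_φ` is the subgroup of `G` fixing `Hg_φ^{•,•}`» (the Hodge tensors of all types `(p,p)`; the tree's point-wise
`hodgeGroupBaseChange`: the fixer of `ι t` for every rational Hodge tensor `t ∈ T^{a,b}` of type `(p,p)`, `(a − b)·n = 2p`);
§V.D p. 164: «[equivalently, `dim(M_φ) ≤ ½ rk(V)`]» for the SCMpHS `V^n_{(F,Π)}`; §V.F p. 172 «`μ(z)|_{V^{p,q}} = z^p`».
B. B. Gordon, *A survey of the Hodge conjecture for abelian varieties* [Gordon1999HodgeAVSurvey] §9.2 (9.2.1) (held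
`paper:arxiv-alg-geom_9709030` p. 25), Pohlmann's condition «`|τΔ ∩ S| = |τΔ ∩ S̄|` for every `τ ∈ G`» (weight one), 2.12
Remark «`Hg(A) ⊆ Ker{Res_{K/ℚ}𝔾_m → Res_{K₀/ℚ}𝔾_m}`».  P. Deligne [Deligne1982HodgeCycles] I §3 (Prop. 3.4, 3.6), Ex. 3.7.

THE MECHANISM (as in the weight-one Part II).  (§6) The degree-`p` descent engine
`hodgeTensorBasis_mem_span_hodgeClasses_of_forall_tensorDegree_eq_ofOrientation`: a tensor basis vector of
`T^{a,b}(V^n_{(F,Π)})` all of whose `Aut(ℂ)`-translates have total degree `p` is a `ℂ`-combination of rational Hodge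
classes of type `(p,p)` (the Galois argument of FILE 1's / g26-#1's degree-`0` engine, verbatim, closed by
`mem_hodgeClasses_of_mem_span_degree`).  (§7, `⊆`) For `γ ∈ Hg(V^n_{(F,Π)})(ℂ)`, `u = γ(1)`: an integer vector `c` with
`2 Σ_σ c_σ deg(τ•σ) = n Σ_σ c_σ` for all `τ` is the character `w_x` of an index `x` of type `(a,b)`, `a − b = Σ c`,
`(a−b)·n = 2p`, all of whose translates have degree `p := Σ_σ c_σ deg σ`; `E_x` is fixed by `γ` and scaled by `χ_x(u)`, so
`∏_σ u_σ^{c_σ} = 1`.  (§8, `⊇`) Conversely the eigen-coordinates of a rational `(p,p)`-class are supported on indices of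
Galois-constant degree `p` (`tensorSpaceToBaseChange_mem_span_degree_eq` + `cmTensorCoord_smul`), whose characters are
orientation-balanced, so a unit killed by all balanced characters fixes every Hodge tensor.  (§10) For a CM field `F`
complex conjugation commutes with `Aut(ℂ)` on `Hom(F,ℂ)`, so a conjugation-SYMMETRIC `c` is balanced
(`Σ_σ c_σ deg(τσ̄) = Σ_σ c_σ (n − deg(τσ))`); with `c = e_σ + e_σ̄`: `u_σ u_σ̄ = 1` on `Hg(V^n_{(F,Π)})(ℂ)`.

WHAT IS PROVED (`F = K : Type` a number field, `Λ : Orientation K n`, `[HodgeTensorFacts.{0,0}]`).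
* §6 **`hodgeTensorBasis_mem_span_hodgeClasses_of_forall_tensorDegree_eq_ofOrientation`** (degree-`p` engine, any eigen-coordinate basis).
* §7 `tensorSpaceActOver_eq_self_of_mem_span_hodgeClasses_ofOrientation_of_mem_hodgeGroupBaseChange`,
  **`prod_embCoords_zpow_eq_one_of_mem_hodgeGroupBaseChange_ofOrientation`** (`Hg(ℂ) ⊆` the balanced torus).
* §8 `tensorDegree_smul_eq_of_cmTensorCoord_ne_zero_ofOrientation`,
  `two_mul_sum_tensorWeight_mul_deg_smul_eq_of_cmTensorCoord_ne_zero_ofOrientation`,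
  **`mem_hodgeGroupBaseChange_ofOrientation_of_forall_prod_embCoords_zpow_eq_one`** (`⊇`).
* §9 **`mem_hodgeGroupBaseChange_complex_ofOrientation_iff`**, **`range_embCoords_apply_one_hodgeGroupBaseChange_complex_ofOrientation`**,
  **`mem_hodgeGroup_ofOrientation_iff`** (rational points), `forall_balanced_of_forall_orthogonal` (every MT-character
  condition is an Hg-character condition: `Hg ⊆ MT` on the torus side).
* §10 (`[IsCMField K]`) `conj_smul_smul_comm` , `two_mul_sum_mul_deg_smul_eq_of_conjugate_symm`,
  **`embCoords_apply_one_mul_embCoords_apply_one_conjugate_of_mem_hodgeGroupBaseChange_ofOrientation`**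
  (`Hg(V^n_{(F,Π)})(ℂ) ⊆ U_F(ℂ)`), `apply_one_mul_conjugate_eq_one_of_mem_hodgeGroup_ofOrientation` (`ℚ`-points: `x·x̄ = 1`).

HONEST SCOPE.  NOT here: equality `Hg(V^n_{(F,Π)})(ℂ) = U_F(ℂ)` for strongly nondegenerate `(F,Π)` (weight one: the tree's
`isNondegenerate_iff_forall_mem_hodgeGroupBaseChange_complex_iff`); real points; abelian varieties / geometric realisations.

## References
* [GreenGriffithsKerr2012] M. Green, P. Griffiths, M. Kerr, *Mumford–Tate Groups and Domains: Their Geometry and Arithmetic*, Ann. of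
  Math. Stud. 183 (2012): §I.B (I.B.1) p. 36; §V.D (V.D.4)–(V.D.5) p. 164; §V.F pp. 172–173.
* [Gordon1999HodgeAVSurvey] B. B. Gordon, *A survey of the Hodge conjecture for abelian varieties*, CRM Monogr. 10 (1999): 2.12, 2.13,
  §9.2 (9.2.1).
* [Deligne1982HodgeCycles] P. Deligne, *Hodge cycles on abelian varieties*, LNM 900 (1982), I §3 (Prop. 3.4, 3.6), Ex. 3.7.
* [Pohlmann1968] H. Pohlmann, Ann. of Math. (2) 88 (1968) 161–180 — Thm. 1.
* [GaoUllmo2025] Z. Gao, E. Ullmo, J. Inst. Math. Jussieu 25 (2025) — proof of Thm. 3.1 (the rational projector).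
-/

noncomputable section

open scoped TensorProduct PiTensorProduct Classical Pointwise
open Polynomial Module NumberField

namespace Literature.AlgebraicGeometry.Motives

namespace HodgeStructure

/-! ### §6 The degree-`p` descent engine for `V^n_{(F,Π)}` -/

section Separating

variable {K : Type} [Field K] [NumberField K]

/-- A non-zero integer combination `Σ_σ c_σ σ` of the complex embeddings of `K` does not vanish identically
(Dedekind / Artin independence).  Private copy of the helper of `Motives/MumfordTateRankOfCMTypeUpperBound`. [folklore] -/
private theorem exists_sum_mul_embedding_ne_zero_p {c : (K →+* ℂ) → ℤ} (hc : c ≠ 0) :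
    ∃ u : K, ∑ σ : K →+* ℂ, (c σ : ℂ) * σ u ≠ 0 := by
  by_contra h
  push Not at h
  have hli : LinearIndependent ℂ fun σ : K →+* ℂ => (σ : K → ℂ) :=
    (linearIndependent_monoidHom K ℂ).comp (fun σ : K →+* ℂ => σ.toMonoidHom)
      fun σ σ' hσ => RingHom.ext fun k => by simpa using DFunLike.congr_fun hσ k
  have hrel : ∑ σ : K →+* ℂ, (c σ : ℂ) • (σ : K → ℂ) = 0 := by
    funext u
    simpa only [Finset.sum_apply, Pi.smul_apply, smul_eq_mul, Pi.zero_apply] using h u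
  have h0 := Fintype.linearIndependent_iff.1 hli (fun σ => (c σ : ℂ)) hrel
  apply hc
  funext σ
  exact_mod_cast h0 σ

/-- A separating element for finitely many non-zero integer vectors. [folklore] -/
private theorem exists_forall_sum_mul_embedding_ne_zero_p (D : Finset ((K →+* ℂ) → ℤ)) :
    ∃ u : K, ∀ c ∈ D, c ≠ 0 → ∑ σ : K →+* ℂ, (c σ : ℂ) * σ u ≠ 0 := by
  set b := Module.finBasis ℚ K with hb
  set d := Module.finrank ℚ K with hd
  set p : ((K →+* ℂ) → ℤ) → ℂ[X] := fun c =>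
    ∑ j : Fin d, Polynomial.monomial (j : ℕ) (∑ σ : K →+* ℂ, (c σ : ℂ) * σ (b j)) with hp_def
  have hpeval : ∀ (c : (K →+* ℂ) → ℤ) (N : ℕ),
      (p c).eval (N : ℂ) = ∑ σ : K →+* ℂ, (c σ : ℂ) * σ (∑ j : Fin d, (N : ℚ) ^ (j : ℕ) • b j) := by
    intro c N
    rw [hp_def]
    simp only [Polynomial.eval_finsetSum, Polynomial.eval_monomial, map_sum, Finset.mul_sum]
    rw [Finset.sum_comm]
    refine Finset.sum_congr rfl fun σ _ => Finset.sum_congr rfl fun j _ => ?_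
    simp only [Algebra.smul_def, map_mul, map_pow, map_natCast]
    ring
  have hpne : ∀ c : (K →+* ℂ) → ℤ, c ≠ 0 → p c ≠ 0 := by
    intro c hc hp0
    obtain ⟨u, hu⟩ := exists_sum_mul_embedding_ne_zero_p hc
    apply hu
    have hcoeff : ∀ j : Fin d, ∑ σ : K →+* ℂ, (c σ : ℂ) * σ (b j) = 0 := by
      intro j
      have h := congrArg (fun q : ℂ[X] => q.coeff (j : ℕ)) hp0
      simp only [hp_def, Polynomial.finsetSum_coeff, Polynomial.coeff_monomial,
        Polynomial.coeff_zero] at h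
      rw [Finset.sum_eq_single j (fun j' _ hj' => if_neg fun h' => hj' (Fin.ext h'.symm).symm)
        (fun hj => absurd (Finset.mem_univ j) hj), if_pos rfl] at h
      exact h
    rw [← b.sum_repr u]
    simp only [map_sum, map_rat_smul, Finset.mul_sum]
    rw [Finset.sum_comm]
    refine Finset.sum_eq_zero fun j _ => ?_
    have : ∑ σ : K →+* ℂ, (c σ : ℂ) * ((b.repr u j) • σ (b j)) =
        ((b.repr u j : ℚ) : ℂ) * ∑ σ : K →+* ℂ, (c σ : ℂ) * σ (b j) := by
      rw [Finset.mul_sum]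
      refine Finset.sum_congr rfl fun σ _ => ?_
      rw [Rat.smul_def]
      ring
    rw [this, hcoeff j, mul_zero]
  set bad : Finset ℂ := (D.filter fun c => c ≠ 0).biUnion fun c => (p c).roots.toFinset with hbad
  obtain ⟨N, hN⟩ : ∃ N : ℕ, (N : ℂ) ∉ bad := by
    by_contra h
    push Not at h
    exact Set.Infinite.mono (Set.range_subset_iff.2 fun N => Finset.mem_coe.2 (h N))
      (Set.infinite_range_of_injective (Nat.cast_injective (R := ℂ))) bad.finite_toSet
  refine ⟨∑ j : Fin d, (N : ℚ) ^ (j : ℕ) • b j, fun c hcD hc0 h0 => hN ?_⟩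
  rw [hbad, Finset.mem_biUnion]
  refine ⟨c, Finset.mem_filter.2 ⟨hcD, hc0⟩, ?_⟩
  rw [Multiset.mem_toFinset, Polynomial.mem_roots (hpne c hc0), Polynomial.IsRoot, hpeval]
  exact h0

end Separating

section EngineP

variable {K : Type} [Field K] [NumberField K] [HodgeTensorFacts.{0, 0}] {n : ℤ} (Λ : Orientation K n)

open RealMult (embCoords)
open Literature.NumberTheory.ComplexMultiplication
open Literature.AlgebraicGeometry.GaoUllmo2025 (galoisClosure corestrict galAct coe_corestrict_apply
  galAct_apply)
open Literature.AlgebraicGeometry.Pohlmann1968 (mem_range_algebraMap_of_forall_gal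
  exists_ringEquiv_extends_gal galAct_toRingHom_injective)

omit [HodgeTensorFacts.{0, 0}] in
/-- The rational tensors span `T^{a,b}_ℂ`. [folklore] -/
private theorem span_range_tensorSpaceToBaseChange_p (a b : ℕ) :
    Submodule.span ℂ (Set.range (tensorSpaceToBaseChange ℂ K a b)) = ⊤ := by
  have h1 : Submodule.span ℂ (Set.range (TensorProduct.mk ℚ ℂ (hodgeTensorSpace K a b) 1)) = ⊤ := by
    rw [← LinearMap.coe_range, ← Submodule.map_top, ← Submodule.baseChange_eq_span,
      Submodule.baseChange_top]
  have h2 : Set.range (tensorSpaceToBaseChange ℂ K a b) =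
      (hodgeTensorSpaceBaseChange K a b).toLinearMap ''
        Set.range (TensorProduct.mk ℚ ℂ (hodgeTensorSpace K a b) 1) := by
    ext s
    simp only [Set.mem_range, Set.mem_image, TensorProduct.mk_apply, exists_exists_eq_and,
      LinearEquiv.coe_coe, hodgeTensorSpaceBaseChange_one_tmul]
  rw [h2, Submodule.span_image, h1, Submodule.map_top, LinearEquiv.range]

omit [HodgeTensorFacts.{0, 0}] in
/-- The comparison map intertwines `ρ(X)` with `ρ(X_ℂ)`. [folklore] -/
private theorem tensorSpaceToBaseChange_tensorDerivation_p {a b : ℕ} (X : Module.End ℚ K)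
    (t : hodgeTensorSpace K a b) :
    tensorSpaceToBaseChange ℂ K a b (tensorDerivation a b X t) =
      tensorDerivation a b (X.baseChange ℂ) (tensorSpaceToBaseChange ℂ K a b t) := by
  rw [← hodgeTensorSpaceBaseChange_one_tmul, ← hodgeTensorSpaceBaseChange_one_tmul,
    ← LinearMap.baseChange_tmul, hodgeTensorSpaceBaseChange_tensorDerivation]

variable {e : Module.Basis (K →+* ℂ) ℂ (ℂ ⊗[ℚ] K)} (he : ∀ x σ, e.repr x σ = embCoords K x σ)
include he

/-- **The degree-`p` descent engine for `V^n_{(F,Π)}`.**  For a tensor basis index `x = (β, γ)` of `T^{a,b}(V^n_{(F,Π)})` ALL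
of whose translates `τ • x`, `τ ∈ Aut(ℂ)`, have total degree `Σₖ deg(τβₖ) − Σₗ deg(τγₗ) = p`, the basis tensor
`(⊗ₖ e_{β k}) ⊗ (⊗ₗ e^∨_{γ l})` lies in the `ℂ`-span of the (complexified) rational Hodge classes of type `(p,p)` of `T^{a,b}`:
the block of indices of Galois-constant degree `p` is `Aut(ℂ)`-stable and separated from its complement by the eigenvalues
`Σₖ βₖ(u) − Σₗ γₗ(u)` of the rational operator `ρ(u)` for a separating `u ∈ F`, so a rational polynomial in `ρ(u)` projects
onto it (`exists_ratPoly_eq_one_eq_zero` over the Galois closure `F^c`, `basis_mem_span_rational_of_ratPoly`), and its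
degree-`p` rational members are Hodge `(p,p)`-classes (`mem_hodgeClasses_of_mem_span_degree`).  The case `p = 0` is g26-#1's
`hodgeTensorBasis_mem_span_hodgeClasses_of_balanced_ofOrientation`; weight one: the tree's
`hodgeTensorBasis_mem_span_hodgeClasses_of_forall_tensorDegree_eq`. [cite: Pohlmann1968, Thm. 1]
[cite: Deligne1982HodgeCycles, I Example 3.7 and proof of Prop. 3.4] [cite: GaoUllmo2025, proof of Thm. 3.1] -/
theorem hodgeTensorBasis_mem_span_hodgeClasses_of_forall_tensorDegree_eq_ofOrientation {a b : ℕ} {p : ℤ}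
    {x : (Fin a → (K →+* ℂ)) × (Fin b → (K →+* ℂ))}
    (hx : ∀ τ : ℂ ≃+* ℂ, tensorDegree Λ.deg (τ • x) = p) :
    hodgeTensorBasis e a b x ∈ Submodule.span ℂ
      (tensorSpaceToBaseChange ℂ K a b '' (((ofOrientation Λ).tensorSpace a b).hodgeClasses p : Set _)) := by
  set deg : (K →+* ℂ) → ℤ := Λ.deg with hdeg
  set B : Set ((Fin a → (K →+* ℂ)) × (Fin b → (K →+* ℂ))) :=
    {y | ∀ τ : ℂ ≃+* ℂ, tensorDegree deg (τ • y) = p} with hB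
  set ch : (Fin a → (K →+* ℂ)) × (Fin b → (K →+* ℂ)) → (K →+* ℂ) → ℤ := fun y => tensorWeight id y with hch
  -- the degree of a translate and the eigenvalue of `ρ(u)` only depend on the character
  have hdeg_smul : ∀ (τ : ℂ ≃+* ℂ) (y : (Fin a → (K →+* ℂ)) × (Fin b → (K →+* ℂ))),
      tensorDegree deg (τ • y) = ∑ σ, ch y σ * deg (τ • σ) := fun τ y =>
    tensorDegree_smul_eq_sum_tensorWeight_mul deg τ y
  have hev : ∀ (u : K) (y : (Fin a → (K →+* ℂ)) × (Fin b → (K →+* ℂ))),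
      (∑ k, (y.1 k) u) - ∑ l, (y.2 l) u = ∑ σ, (ch y σ : ℂ) * σ u := by
    intro u y
    have h := sum_tensorWeight_smul (A := ℂ) id y fun σ : K →+* ℂ => σ u
    simp only [zsmul_eq_mul, id_eq] at h
    rw [hch, h]
  have hB_of_ch : ∀ y z : (Fin a → (K →+* ℂ)) × (Fin b → (K →+* ℂ)), ch y = ch z → (y ∈ B ↔ z ∈ B) := by
    intro y z hyz
    simp only [hB, Set.mem_setOf_eq, hdeg_smul, hyz]
  -- a separating element for the finitely many character differences
  obtain ⟨u, hu⟩ := exists_forall_sum_mul_embedding_ne_zero_p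
    ((Finset.univ : Finset (((Fin a → (K →+* ℂ)) × (Fin b → (K →+* ℂ))) ×
      ((Fin a → (K →+* ℂ)) × (Fin b → (K →+* ℂ))))).image fun yz => ch yz.1 - ch yz.2)
  have hsepI : ∀ y z : (Fin a → (K →+* ℂ)) × (Fin b → (K →+* ℂ)),
      (∑ k, (y.1 k) u) - ∑ l, (y.2 l) u = (∑ k, (z.1 k) u) - ∑ l, (z.2 l) u → ch y = ch z := by
    intro y z hyz
    by_contra hne
    refine hu (ch y - ch z) (Finset.mem_image.2 ⟨(y, z), Finset.mem_univ _, rfl⟩)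
      (sub_ne_zero.2 hne) ?_
    simp only [Pi.sub_apply, Int.cast_sub, sub_mul, Finset.sum_sub_distrib, ← hev, hyz, sub_self]
  -- the Galois data over `F^c`
  set eF : (Fin a → (K →+* ℂ)) × (Fin b → (K →+* ℂ)) → galoisClosure K := fun y =>
    (∑ k, corestrict K (y.1 k).toRatAlgHom u) - ∑ l, corestrict K (y.2 l).toRatAlgHom u with heF
  have heF_coe : ∀ y : (Fin a → (K →+* ℂ)) × (Fin b → (K →+* ℂ)),
      ((eF y : galoisClosure K) : ℂ) = (∑ k, (y.1 k) u) - ∑ l, (y.2 l) u := by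
    intro y
    simp only [heF, AddSubgroupClass.coe_sub, AddSubmonoidClass.coe_finsetSum, coe_corestrict_apply,
      RingHom.toRatAlgHom_apply]
  set pS : (galoisClosure K ≃ₐ[ℚ] galoisClosure K) → (K →+* ℂ) → (K →+* ℂ) :=
    fun τ σ => (galAct K τ σ.toRatAlgHom).toRingHom with hpS
  set perm : (galoisClosure K ≃ₐ[ℚ] galoisClosure K) →
      (Fin a → (K →+* ℂ)) × (Fin b → (K →+* ℂ)) → (Fin a → (K →+* ℂ)) × (Fin b → (K →+* ℂ)) :=
    fun τ y => (fun k => pS τ (y.1 k), fun l => pS τ (y.2 l)) with hperm_def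
  have hpS_ext : ∀ τ : galoisClosure K ≃ₐ[ℚ] galoisClosure K, ∃ τ' : ℂ ≃+* ℂ,
      ∀ y : (Fin a → (K →+* ℂ)) × (Fin b → (K →+* ℂ)), perm τ y = τ' • y := by
    intro τ
    obtain ⟨τ', hτ'⟩ := exists_ringEquiv_extends_gal (K := K) τ
    refine ⟨τ', fun y => Prod.ext (funext fun k => ?_) (funext fun l => ?_)⟩
    · show (galAct K τ (y.1 k).toRatAlgHom).toRingHom = τ' • y.1 k
      rw [ringEquiv_smul_def, RingEquiv.toRingHom_eq_coe, hτ']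
    · show (galAct K τ (y.2 l).toRatAlgHom).toRingHom = τ' • y.2 l
      rw [ringEquiv_smul_def, RingEquiv.toRingHom_eq_coe, hτ']
  have hinj : ∀ τ : galoisClosure K ≃ₐ[ℚ] galoisClosure K, Function.Injective (perm τ) := by
    intro τ y z hyz
    have h1 : ∀ k, pS τ (y.1 k) = pS τ (z.1 k) := fun k => congr_fun (congrArg Prod.fst hyz) k
    have h2 : ∀ l, pS τ (y.2 l) = pS τ (z.2 l) := fun l => congr_fun (congrArg Prod.snd hyz) l
    exact Prod.ext (funext fun k => galAct_toRingHom_injective τ (h1 k))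
      (funext fun l => galAct_toRingHom_injective τ (h2 l))
  have hperm : ∀ (τ : galoisClosure K ≃ₐ[ℚ] galoisClosure K)
      (y : (Fin a → (K →+* ℂ)) × (Fin b → (K →+* ℂ))),
      (τ : galoisClosure K →+* galoisClosure K) (eF y) = eF (perm τ y) := by
    intro τ y
    simp only [heF, map_sub, map_sum]
    congr 1
  have hfix : ∀ z : galoisClosure K, (∀ τ : galoisClosure K ≃ₐ[ℚ] galoisClosure K,
      (τ : galoisClosure K →+* galoisClosure K) z = z) → z ∈ Set.range (algebraMap ℚ (galoisClosure K)) :=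
    fun z hz => mem_range_algebraMap_of_forall_gal z fun τ => hz τ
  have hBs : ∀ (τ : galoisClosure K ≃ₐ[ℚ] galoisClosure K), ∀ y ∈ B.toFinset, perm τ y ∈ B.toFinset := by
    intro τ y hy
    rw [Set.mem_toFinset] at hy ⊢
    obtain ⟨τ', hτ'⟩ := hpS_ext τ
    rw [hτ']
    intro g
    rw [smul_smul]
    exact hy (g * τ')
  have hsep : ∀ y ∈ B.toFinset, ∀ z ∉ B.toFinset, eF y ≠ eF z := by
    intro y hy z hz hyz
    rw [Set.mem_toFinset] at hy hz
    have h := congrArg (fun w : galoisClosure K => (w : ℂ)) hyz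
    simp only [heF_coe] at h
    exact hz ((hB_of_ch y z (hsepI y z h)).1 hy)
  obtain ⟨P, hP1, hP0⟩ := exists_ratPoly_eq_one_eq_zero (algebraMap (galoisClosure K) ℂ) eF
    (fun τ : galoisClosure K ≃ₐ[ℚ] galoisClosure K => (τ : galoisClosure K →+* galoisClosure K))
    perm hinj hperm hfix B.toFinset hBs hsep
  -- the engine
  have hxB : x ∈ B := hx
  have hE : ∀ y : (Fin a → (K →+* ℂ)) × (Fin b → (K →+* ℂ)),
      tensorDerivation a b ((Algebra.lmul ℚ K u : Module.End ℚ K).baseChange ℂ) (hodgeTensorBasis e a b y) =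
        ((∑ k, (y.1 k) u) - ∑ l, (y.2 l) u) • hodgeTensorBasis e a b y :=
    fun y => tensorDerivation_hodgeTensorBasis' e (lmul_baseChange_basis he u) y
  have hP1' : ∀ y ∈ B, (P.map (algebraMap ℚ ℂ)).eval ((∑ k, (y.1 k) u) - ∑ l, (y.2 l) u) = 1 :=
    fun y hy => by rw [← heF_coe]; exact hP1 y (Set.mem_toFinset.2 hy)
  have hP0' : ∀ y ∉ B, (P.map (algebraMap ℚ ℂ)).eval ((∑ k, (y.1 k) u) - ∑ l, (y.2 l) u) = 0 :=
    fun y hy => by rw [← heF_coe]; exact hP0 y (fun h => hy (Set.mem_toFinset.1 h))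
  have key := basis_mem_span_rational_of_ratPoly (T := hodgeTensorSpace K a b)
    (TC := hodgeTensorSpaceOver ℂ (ℂ ⊗[ℚ] K) a b) (tensorSpaceToBaseChange ℂ K a b)
    (span_range_tensorSpaceToBaseChange_p a b)
    (tensorDerivation a b (Algebra.lmul ℚ K u : Module.End ℚ K))
    (tensorDerivation a b ((Algebra.lmul ℚ K u : Module.End ℚ K).baseChange ℂ))
    (tensorSpaceToBaseChange_tensorDerivation_p (Algebra.lmul ℚ K u : Module.End ℚ K))
    (hodgeTensorBasis e a b) (fun y => (∑ k, (y.1 k) u) - ∑ l, (y.2 l) u) hE B P hP1' hP0' hxB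
  refine Submodule.span_mono (Set.image_mono fun t ht => ?_) key
  -- the block consists of degree-`p` tensors, hence its rational members are Hodge `(p,p)`-classes
  refine mem_hodgeClasses_of_mem_span_degree (ofOrientation Λ) e (ofOrientation_F_eq_span_basis Λ he)
    (Submodule.span_mono (Set.image_mono fun y hy => ?_) ht)
  have h : tensorDegree deg ((1 : ℂ ≃+* ℂ) • y) = p := hy 1
  rwa [one_smul] at h

end EngineP

variable {K : Type} [Field K] [NumberField K] {n : ℤ} (Λ : Orientation K n)

open RealMult (embCoords embCoords_tmul)
open Literature.NumberTheory.ComplexMultiplication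

/-! ### §7 `Hg(V^n_{(F,Π)})(ℂ)` is killed by every orientation-balanced character -/

variable [HodgeTensorFacts.{0, 0}]

/-- **`Hg(H)(ℂ)` fixes the `ℂ`-span of the complexified rational Hodge classes of type `(p,p)` of `T^{a,b}`** (`(a − b)·n = 2p`),
by definition of the point-wise Hodge group and linearity. [cite: GreenGriffithsKerr2012, §I.B (I.B.1)] -/
theorem tensorSpaceActOver_eq_self_of_mem_span_hodgeClasses_ofOrientation_of_mem_hodgeGroupBaseChange
    {γ : (ℂ ⊗[ℚ] K) ≃ₗ[ℂ] (ℂ ⊗[ℚ] K)} (hγ : γ ∈ (ofOrientation Λ).hodgeGroupBaseChange ℂ) {a b : ℕ} {p : ℤ}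
    (hab : ((a : ℤ) - b) * n = 2 * p) {s : hodgeTensorSpaceOver ℂ (ℂ ⊗[ℚ] K) a b}
    (hs : s ∈ Submodule.span ℂ (tensorSpaceToBaseChange ℂ K a b ''
      (((ofOrientation Λ).tensorSpace a b).hodgeClasses p : Set (hodgeTensorSpace K a b)))) :
    tensorSpaceActOver γ s = s := by
  induction hs using Submodule.span_induction with
  | mem s hs =>
    obtain ⟨t, ht, rfl⟩ := hs
    exact (mem_hodgeGroupBaseChange_iff ℂ (ofOrientation Λ) γ).1 hγ a b p hab t ht
  | zero => exact map_zero _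
  | add s₁ s₂ _ _ h₁ h₂ => rw [map_add, h₁, h₂]
  | smul c s _ h => rw [map_smul, h]

/-- **An orientation-balanced character kills `Hg(V^n_{(F,Π)})(ℂ)`** (GGK (I.B.1) for `V^n_{(F,Π)}` on `ℂ`-points, `⊆` half): for
`γ ∈ Hg(V^n_{(F,Π)})(ℂ)`, `u = γ(1)`, and every integer vector `c` on `Hom(F, ℂ)` with `2 Σ_σ c_σ deg(τ•σ) = n Σ_σ c_σ` for all
`τ ∈ Aut(ℂ)` (the weight-`n` form of Pohlmann's condition (9.2.1)), the character `χ_c` kills `u`: **`∏_σ u_σ^{c_σ} = 1`** —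
`c = w_x` for an index `x` of `T^{a,b}`, `a − b = Σ c`, `(a−b)·n = 2p` with `p = Σ_σ c_σ deg σ`, all of whose translates have degree
`p`, so `E_x` is a combination of Hodge `(p,p)`-classes (§6), fixed by `γ`, while `γ · E_x = χ_x(u) E_x`.
[cite: GreenGriffithsKerr2012, §I.B (I.B.1)] [cite: Gordon1999HodgeAVSurvey, §9.2 (9.2.1)] -/
theorem prod_embCoords_zpow_eq_one_of_mem_hodgeGroupBaseChange_ofOrientation {γ : (ℂ ⊗[ℚ] K) ≃ₗ[ℂ] (ℂ ⊗[ℚ] K)}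
    (hγ : γ ∈ (ofOrientation Λ).hodgeGroupBaseChange ℂ) (c : (K →+* ℂ) → ℤ)
    (hc : ∀ τ : ℂ ≃+* ℂ, 2 * ∑ σ, c σ * Λ.deg (τ • σ) = n * ∑ σ, c σ) :
    ∏ σ, embCoords K (γ 1) σ ^ c σ = 1 := by
  have hγK : ∀ y, γ y = y * γ 1 := hodgeGroupBaseChange_ofOrientation_apply ℂ Λ hγ
  obtain ⟨a, b, x, rfl, hab⟩ := exists_tensorWeight_eq_of_sum c
  set p : ℤ := ∑ σ, tensorWeight id x σ * Λ.deg ((1 : ℂ ≃+* ℂ) • σ) with hp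
  have h2p : ((a : ℤ) - b) * n = 2 * p := by rw [hab, hp, mul_comm]; exact (hc 1).symm
  have hxdeg : ∀ τ : ℂ ≃+* ℂ, tensorDegree Λ.deg (τ • x) = p := by
    intro τ
    rw [tensorDegree_smul_eq_sum_tensorWeight_mul]
    have h1 := hc τ
    have h2 := hc 1
    omega
  have hfix := tensorSpaceActOver_eq_self_of_mem_span_hodgeClasses_ofOrientation_of_mem_hodgeGroupBaseChange Λ hγ h2p
    (hodgeTensorBasis_mem_span_hodgeClasses_of_forall_tensorDegree_eq_ofOrientation Λ (e := cmBasis K) cmBasis_repr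
      hxdeg)
  rw [tensorSpaceActOver_hodgeTensorBasis_of_forall_apply_eq_mul hγK] at hfix
  have h := congrArg (fun v => (hodgeTensorBasis (cmBasis K) a b).repr v x) hfix
  simp only [map_smul, Module.Basis.repr_self, Finsupp.smul_apply, Finsupp.single_eq_same, smul_eq_mul,
    mul_one] at h
  exact h

/-! ### §8 A unit killed by the orientation-balanced characters fixes every rational Hodge tensor of every type `(p,p)` -/

/-- **The eigen-coordinates of a rational Hodge `(p,p)`-class of `V^n_{(F,Π)}` are supported on indices of Galois-CONSTANT degree
`p`**: if `t ∈ T^{a,b}(F)`, `(a − b)·n = 2p`, is a rational Hodge class of type `(p,p)` and its coordinate at `y` is non-zero, then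
`deg_Π(τ • y) = p` for every `τ ∈ Aut(ℂ)` (`ι t ∈ span {E_y | deg y = p}` and `coord_{τ•y}(t) = τ(coord_y(t)) ≠ 0`).
[cite: Deligne1982HodgeCycles, I Example 3.7 (c)] [cite: Pohlmann1968, Thm. 1] -/
theorem tensorDegree_smul_eq_of_cmTensorCoord_ne_zero_ofOrientation {a b : ℕ} {p : ℤ} (hab : ((a : ℤ) - b) * n = 2 * p)
    {t : hodgeTensorSpace K a b} (ht : t ∈ ((ofOrientation Λ).tensorSpace a b).hodgeClasses p)
    {y : (Fin a → (K →+* ℂ)) × (Fin b → (K →+* ℂ))} (hy : cmTensorCoord y t ≠ 0) (τ : ℂ ≃+* ℂ) :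
    tensorDegree Λ.deg (τ • y) = p := by
  have hτy : cmTensorCoord (τ • y) t ≠ 0 := by
    rw [cmTensorCoord_smul]
    exact (map_ne_zero_iff (τ : ℂ →+* ℂ) (τ : ℂ →+* ℂ).injective).2 hy
  have hmem := tensorSpaceToBaseChange_mem_span_degree_eq (ofOrientation Λ) (cmBasis K) (ofOrientation_F_eq_span Λ)
    (complexConj_ofOrientation_F_eq_span Λ) hab ht
  rw [(hodgeTensorBasis (cmBasis K) a b).mem_span_image] at hmem
  exact hmem (by rw [Finset.mem_coe, Finsupp.mem_support_iff, ← cmTensorCoord_apply]; exact hτy)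

/-- … hence **the character `w_y` of such an index is orientation-balanced**: `2 Σ_σ w_y(σ) deg(τ•σ) = n Σ_σ w_y(σ)` (`= n(a − b) =
2p`) for every `τ`. [cite: Gordon1999HodgeAVSurvey, §9.2 (9.2.1)] [cite: GreenGriffithsKerr2012, §I.B (I.B.1)] -/
theorem two_mul_sum_tensorWeight_mul_deg_smul_eq_of_cmTensorCoord_ne_zero_ofOrientation {a b : ℕ} {p : ℤ}
    (hab : ((a : ℤ) - b) * n = 2 * p) {t : hodgeTensorSpace K a b}
    (ht : t ∈ ((ofOrientation Λ).tensorSpace a b).hodgeClasses p)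
    {y : (Fin a → (K →+* ℂ)) × (Fin b → (K →+* ℂ))} (hy : cmTensorCoord y t ≠ 0) (τ : ℂ ≃+* ℂ) :
    2 * ∑ σ, tensorWeight id y σ * Λ.deg (τ • σ) = n * ∑ σ, tensorWeight id y σ := by
  rw [← tensorDegree_smul_eq_sum_tensorWeight_mul, tensorDegree_smul_eq_of_cmTensorCoord_ne_zero_ofOrientation Λ hab ht hy τ,
    sum_tensorWeight_eq_sub]
  linarith [hab]

/-- **`{orientation-balanced characters = 1} ⊆ Hg(V^n_{(F,Π)})(ℂ)`** (GGK (I.B.1) on `ℂ`-points, `⊇` half).  Let `γ ∈ GL(ℂ ⊗ F)` be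
multiplication by a unit `u = γ(1)` with `∏_σ u_σ^{c_σ} = 1` for every integer vector `c` with `2 Σ_σ c_σ deg(τ•σ) = n Σ_σ c_σ` for all
`τ ∈ Aut(ℂ)`.  Then `γ` fixes the complexification of every rational Hodge tensor of every type `(p,p)`: **`γ ∈ Hg(V^n_{(F,Π)})(ℂ)`**.
[cite: GreenGriffithsKerr2012, §I.B (I.B.1)] [cite: Gordon1999HodgeAVSurvey, §9.2 (9.2.1)] -/
theorem mem_hodgeGroupBaseChange_ofOrientation_of_forall_prod_embCoords_zpow_eq_one
    {γ : (ℂ ⊗[ℚ] K) ≃ₗ[ℂ] (ℂ ⊗[ℚ] K)} (hγK : ∀ x, γ x = x * γ 1)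
    (hγ : ∀ c : (K →+* ℂ) → ℤ, (∀ τ : ℂ ≃+* ℂ, 2 * ∑ σ, c σ * Λ.deg (τ • σ) = n * ∑ σ, c σ) →
      ∏ σ, embCoords K (γ 1) σ ^ c σ = 1) :
    γ ∈ (ofOrientation Λ).hodgeGroupBaseChange ℂ := by
  rw [mem_hodgeGroupBaseChange_iff]
  intro a b p hab t ht
  have key : ∀ y : (Fin a → (K →+* ℂ)) × (Fin b → (K →+* ℂ)),
      (hodgeTensorBasis (cmBasis K) a b).repr (tensorSpaceToBaseChange ℂ K a b t) y •
          tensorSpaceActOver γ (hodgeTensorBasis (cmBasis K) a b y) =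
        (hodgeTensorBasis (cmBasis K) a b).repr (tensorSpaceToBaseChange ℂ K a b t) y •
          hodgeTensorBasis (cmBasis K) a b y := by
    intro y
    by_cases hy : (hodgeTensorBasis (cmBasis K) a b).repr (tensorSpaceToBaseChange ℂ K a b t) y = 0
    · rw [hy, zero_smul, zero_smul]
    · have hy' : cmTensorCoord y t ≠ 0 := by rwa [cmTensorCoord_apply]
      rw [tensorSpaceActOver_hodgeTensorBasis_of_forall_apply_eq_mul hγK y,
        hγ _ (two_mul_sum_tensorWeight_mul_deg_smul_eq_of_cmTensorCoord_ne_zero_ofOrientation Λ hab ht hy'), one_smul]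
  calc tensorSpaceActOver γ (tensorSpaceToBaseChange ℂ K a b t)
      = tensorSpaceActOver γ (∑ y, (hodgeTensorBasis (cmBasis K) a b).repr
          (tensorSpaceToBaseChange ℂ K a b t) y • hodgeTensorBasis (cmBasis K) a b y) := by
        rw [Module.Basis.sum_repr]
    _ = ∑ y, (hodgeTensorBasis (cmBasis K) a b).repr (tensorSpaceToBaseChange ℂ K a b t) y •
          tensorSpaceActOver γ (hodgeTensorBasis (cmBasis K) a b y) := by
        rw [map_sum]
        exact Finset.sum_congr rfl fun y _ => map_smul _ _ _
    _ = ∑ y, (hodgeTensorBasis (cmBasis K) a b).repr (tensorSpaceToBaseChange ℂ K a b t) y •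
          hodgeTensorBasis (cmBasis K) a b y := Finset.sum_congr rfl fun y _ => key y
    _ = tensorSpaceToBaseChange ℂ K a b t := Module.Basis.sum_repr _ _

/-! ### §9 `Hg(V^n_{(F,Π)})(ℂ)` = the subtorus cut out by the orientation-balanced characters; rational points -/

/-- **GGK (I.B.1) for the strong CM-Hodge structure `V^n_{(F,Π)}`, on `ℂ`-points: `Hg(V^n_{(F,Π)})(ℂ)` IS the subtorus of
`Res_{F/ℚ}𝔾_m(ℂ)` cut out by the orientation-balanced characters.**  `γ ∈ GL(ℂ ⊗ F)` lies in the Hodge group iff `γ` is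
multiplication by a unit `u = γ(1)` with `∏_σ u_σ^{c_σ} = 1` for every integer vector `c` on `Hom(F,ℂ)` with
`2 Σ_σ c_σ deg(τ•σ) = n Σ_σ c_σ` for all `τ ∈ Aut(ℂ)`.  Compare FILE 1: the Mumford–Tate group is cut out by the balanced vectors
with `(Σ c)·n = 0` and `Σ_σ c_σ deg(τ•σ) = 0` only. [cite: GreenGriffithsKerr2012, §I.B (I.B.1)] [cite: Gordon1999HodgeAVSurvey, §9.2 (9.2.1)] -/
theorem mem_hodgeGroupBaseChange_complex_ofOrientation_iff (γ : (ℂ ⊗[ℚ] K) ≃ₗ[ℂ] (ℂ ⊗[ℚ] K)) :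
    γ ∈ (ofOrientation Λ).hodgeGroupBaseChange ℂ ↔
      (∀ x, γ x = x * γ 1) ∧ ∀ c : (K →+* ℂ) → ℤ,
        (∀ τ : ℂ ≃+* ℂ, 2 * ∑ σ, c σ * Λ.deg (τ • σ) = n * ∑ σ, c σ) → ∏ σ, embCoords K (γ 1) σ ^ c σ = 1 :=
  ⟨fun hγ => ⟨hodgeGroupBaseChange_ofOrientation_apply ℂ Λ hγ,
      prod_embCoords_zpow_eq_one_of_mem_hodgeGroupBaseChange_ofOrientation Λ hγ⟩,
    fun h => mem_hodgeGroupBaseChange_ofOrientation_of_forall_prod_embCoords_zpow_eq_one Λ h.1 h.2⟩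

/-- **`Hg(V^n_{(F,Π)})(ℂ) ⊆ (ℂ^×)^{Hom(F,ℂ)}`, explicitly**: under `γ ↦ (γ(1)_σ)_σ` the `ℂ`-points of the Hodge group are EXACTLY the
vectors `c ∈ (ℂ^×)^{Hom(F,ℂ)}` with `∏_σ c_σ^{c′_σ} = 1` for every orientation-balanced `c′`.
[cite: GreenGriffithsKerr2012, §I.B (I.B.1)] [cite: Gordon1999HodgeAVSurvey, §9.2 (9.2.1)] -/
theorem range_embCoords_apply_one_hodgeGroupBaseChange_complex_ofOrientation :
    Set.range (fun γ : (ofOrientation Λ).hodgeGroupBaseChange ℂ =>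
        embCoords K ((γ : (ℂ ⊗[ℚ] K) ≃ₗ[ℂ] (ℂ ⊗[ℚ] K)) 1)) =
      {c : (K →+* ℂ) → ℂ | (∀ σ, c σ ≠ 0) ∧ ∀ c' : (K →+* ℂ) → ℤ,
        (∀ τ : ℂ ≃+* ℂ, 2 * ∑ σ, c' σ * Λ.deg (τ • σ) = n * ∑ σ, c' σ) → ∏ σ, c σ ^ c' σ = 1} := by
  ext c
  constructor
  · rintro ⟨γ, rfl⟩
    exact ⟨embCoords_apply_one_ne_zero_of_forall_apply_eq_mul (hodgeGroupBaseChange_ofOrientation_apply ℂ Λ γ.2),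
      prod_embCoords_zpow_eq_one_of_mem_hodgeGroupBaseChange_ofOrientation Λ γ.2⟩
  · rintro ⟨hc0, hc⟩
    obtain ⟨γ, hγK, hγ1⟩ := exists_linearEquiv_forall_apply_eq_mul _ _
      (embCoords_symm_mul_embCoords_symm_inv hc0)
    have hcγ : embCoords K (γ 1) = c := by rw [hγ1, LinearEquiv.apply_symm_apply]
    refine ⟨⟨γ, mem_hodgeGroupBaseChange_ofOrientation_of_forall_prod_embCoords_zpow_eq_one Λ hγK fun c' hc' => ?_⟩,
      hcγ⟩
    rw [hcγ]
    exact hc c' hc'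

/-- **GGK (I.B.1) for `V^n_{(F,Π)}` on RATIONAL points.**  A rational automorphism `g` of `V = F` lies in `Hg(V^n_{(F,Π)})(ℚ)` (the
tree's Tannaka-free `hodgeGroup`) iff `g` is multiplication by `x = g(1) ∈ F^×` (p29's `hodgeGroup_ofOrientation_apply`) AND
`∏_σ σ(x)^{c_σ} = 1` for every orientation-balanced integer vector `c`; via `Hg(ℚ) = GL(V)(ℚ) ∩ Hg(ℂ)`
(`mem_hodgeGroup_iff_glBaseChange_mem`). [cite: GreenGriffithsKerr2012, §I.B (I.B.1)] [cite: Gordon1999HodgeAVSurvey, §9.2 (9.2.1)] -/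
theorem mem_hodgeGroup_ofOrientation_iff (g : K ≃ₗ[ℚ] K) :
    g ∈ (ofOrientation Λ).hodgeGroup ↔
      (∀ v, g v = v * g 1) ∧ ∀ c : (K →+* ℂ) → ℤ,
        (∀ τ : ℂ ≃+* ℂ, 2 * ∑ σ, c σ * Λ.deg (τ • σ) = n * ∑ σ, c σ) → ∏ σ : K →+* ℂ, σ (g 1) ^ c σ = 1 := by
  constructor
  · intro hg
    have hgK : ∀ v, g v = v * g 1 := fun v => by rw [hodgeGroup_ofOrientation_apply Λ hg v, mul_comm]
    refine ⟨hgK, fun c hc => ?_⟩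
    have h := prod_embCoords_zpow_eq_one_of_mem_hodgeGroupBaseChange_ofOrientation Λ
      ((mem_hodgeGroup_iff_glBaseChange_mem ℂ (ofOrientation Λ) g).1 hg) c hc
    simpa only [embCoords_glBaseChange_apply_one] using h
  · rintro ⟨hgK, hg⟩
    rw [mem_hodgeGroup_iff_glBaseChange_mem ℂ]
    refine mem_hodgeGroupBaseChange_ofOrientation_of_forall_prod_embCoords_zpow_eq_one Λ
      (glBaseChange_apply_eq_mul_of_forall_apply_eq_mul hgK) fun c hc => ?_
    simpa only [embCoords_glBaseChange_apply_one] using hg c hc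

omit [HodgeTensorFacts.{0, 0}] in
/-- **Every character condition of the Mumford–Tate torus is one of the Hodge torus** (`Hg ⊆ MT` on the character side): a vector
orthogonal to all translated degree vectors (`Σ_σ c_σ deg(τ•σ) = 0`) has `(Σ c)·n = 0` (FILE 1) and is therefore orientation-balanced.
[cite: GreenGriffithsKerr2012, §I.B (I.B.1) and §V.D p. 164] -/
theorem forall_balanced_of_forall_orthogonal (c : (K →+* ℂ) → ℤ) (hc : ∀ τ : ℂ ≃+* ℂ, ∑ σ, c σ * Λ.deg (τ • σ) = 0)
    (τ : ℂ ≃+* ℂ) : 2 * ∑ σ, c σ * Λ.deg (τ • σ) = n * ∑ σ, c σ := by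
  rw [hc τ, mul_zero, mul_comm, sum_mul_eq_zero_of_forall_sum_mul_deg_smul_eq_zero Λ c hc]

/-- Hence **`Hg(V^n_{(F,Π)})(ℂ) ⊆ MT(V^n_{(F,Π)})(ℂ)`** read through the two character descriptions (a sanity check of FILE 1 / FILE 2;
the tree's general `hodgeGroupBaseChange_le_mumfordTateGroupBaseChange` is not assumed here). [cite: GreenGriffithsKerr2012, §I.B (I.B.1)] -/
theorem mem_mumfordTateGroupBaseChange_of_mem_hodgeGroupBaseChange_ofOrientation {γ : (ℂ ⊗[ℚ] K) ≃ₗ[ℂ] (ℂ ⊗[ℚ] K)}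
    (hγ : γ ∈ (ofOrientation Λ).hodgeGroupBaseChange ℂ) : γ ∈ (ofOrientation Λ).mumfordTateGroupBaseChange ℂ :=
  (mem_mumfordTateGroupBaseChange_complex_ofOrientation_iff Λ γ).2
    ⟨hodgeGroupBaseChange_ofOrientation_apply ℂ Λ hγ, fun c hc =>
      prod_embCoords_zpow_eq_one_of_mem_hodgeGroupBaseChange_ofOrientation Λ hγ c
        (forall_balanced_of_forall_orthogonal Λ c hc)⟩

/-! ### §10 CM fields: `Hg(V^n_{(F,Π)})(ℂ) ⊆ U_F(ℂ) = {u | u_σ u_σ̄ = 1}` -/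

section CMField

variable [IsCMField K]

omit [HodgeTensorFacts.{0, 0}] in
/-- For a CM field, complex conjugation on `Hom(F, ℂ)` commutes with the action of `Aut(ℂ)`: `τ • σ̄ = conj(τ • σ)` (both are
`x ↦ τ(σ(ι x))` for the complex conjugation `ι` of `F`; the tree's `IsCMField.complexEmbedding_complexConj`).
[cite: Gordon1999HodgeAVSurvey, §9.2] -/
theorem smul_conjugate_eq_conjugate_smul (τ : ℂ ≃+* ℂ) (σ : K →+* ℂ) :
    τ • ComplexEmbedding.conjugate σ = ComplexEmbedding.conjugate (τ • σ) := by
  refine RingHom.ext fun x => ?_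
  change τ (starRingEnd ℂ (σ x)) = starRingEnd ℂ (τ (σ x))
  rw [← IsCMField.complexEmbedding_complexConj K σ x]
  exact IsCMField.complexEmbedding_complexConj K ((τ : ℂ →+* ℂ).comp σ) x

omit [HodgeTensorFacts.{0, 0}] in
/-- **A conjugation-SYMMETRIC integer vector is orientation-balanced** (`c_σ̄ = c_σ` for all `σ` ⟹ `2 Σ_σ c_σ deg(τ•σ) = n Σ_σ c_σ`
for all `τ`): reindex by `σ ↦ σ̄` and use `deg(conj θ) = n − deg θ` — the divisor-type weights; weight one: the tree's
`two_mul_sum_mul_indicator_smul_eq_sum_of_conjugate_symm`. [cite: Gordon1999HodgeAVSurvey, §9.2 (9.2.1)] [cite: GreenGriffithsKerr2012, §V.A p. 154] -/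
theorem two_mul_sum_mul_deg_smul_eq_of_conjugate_symm (c : (K →+* ℂ) → ℤ)
    (hc : ∀ σ, c (ComplexEmbedding.conjugate σ) = c σ) (τ : ℂ ≃+* ℂ) :
    2 * ∑ σ, c σ * Λ.deg (τ • σ) = n * ∑ σ, c σ := by
  have hinv : Function.Involutive (ComplexEmbedding.conjugate : (K →+* ℂ) → (K →+* ℂ)) :=
    ComplexEmbedding.involutive_conjugate K
  have hre : ∑ σ, c σ * Λ.deg (τ • σ) = ∑ σ, c σ * (n - Λ.deg (τ • σ)) := by
    calc ∑ σ, c σ * Λ.deg (τ • σ)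
        = ∑ σ, c (ComplexEmbedding.conjugate σ) * Λ.deg (τ • ComplexEmbedding.conjugate σ) :=
          (Fintype.sum_equiv hinv.toPerm _ _ fun σ => by
            simp only [Function.Involutive.coe_toPerm, hinv σ])
      _ = ∑ σ, c σ * (n - Λ.deg (τ • σ)) := Finset.sum_congr rfl fun σ _ => by
          rw [hc, smul_conjugate_eq_conjugate_smul, Λ.deg_conjugate]
  have h2 : 2 * ∑ σ, c σ * Λ.deg (τ • σ) = ∑ σ, c σ * Λ.deg (τ • σ) + ∑ σ, c σ * (n - Λ.deg (τ • σ)) := by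
    rw [← hre, two_mul]
  rw [h2, ← Finset.sum_add_distrib, Finset.mul_sum]
  exact Finset.sum_congr rfl fun σ _ => by ring

omit [IsCMField K] [HodgeTensorFacts.{0, 0}] in
/-- The product of a character supported on `{σ₀}`: `∏_σ c_σ^{[σ = σ₀]} = c_{σ₀}`. [folklore] -/
private theorem prod_zpow_ite_eq_single' (c : (K →+* ℂ) → ℂ) (σ₀ : K →+* ℂ) :
    ∏ σ, c σ ^ (if σ = σ₀ then (1 : ℤ) else 0) = c σ₀ := by
  rw [Finset.prod_eq_single σ₀]
  · rw [if_pos rfl, zpow_one]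
  · intro σ _ hσ
    rw [if_neg hσ, zpow_zero]
  · intro h
    exact absurd (Finset.mem_univ σ₀) h

/-- **`Hg(V^n_{(F,Π)})(ℂ) ⊆ U_F(ℂ)`** for a CM field `F`, in every weight: for `γ ∈ Hg(V^n_{(F,Π)})(ℂ)`, `u = γ(1)`, and every
`σ₀ ∈ Hom(F, ℂ)`, **`u_{σ₀} · u_{σ̄₀} = 1`** — the symmetric vector `e_{σ₀} + e_{σ̄₀}` is orientation-balanced (on the Deligne torus:
`h(z)(1)_σ h(z)(1)_σ̄ = (z z̄)^n = 1` for `|z| = 1`; Gordon 2.12 «`Hg(A) ⊆ Ker{Res_{K/ℚ}𝔾_m → Res_{K₀/ℚ}𝔾_m}`» in higher weight).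
[cite: Gordon1999HodgeAVSurvey, 2.12] [cite: GreenGriffithsKerr2012, §V.D p. 164] -/
theorem embCoords_apply_one_mul_embCoords_apply_one_conjugate_of_mem_hodgeGroupBaseChange_ofOrientation
    {γ : (ℂ ⊗[ℚ] K) ≃ₗ[ℂ] (ℂ ⊗[ℚ] K)} (hγ : γ ∈ (ofOrientation Λ).hodgeGroupBaseChange ℂ) (σ₀ : K →+* ℂ) :
    embCoords K (γ 1) σ₀ * embCoords K (γ 1) (ComplexEmbedding.conjugate σ₀) = 1 := by
  set c : (K →+* ℂ) → ℤ := fun σ =>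
    (if σ = σ₀ then (1 : ℤ) else 0) + (if σ = ComplexEmbedding.conjugate σ₀ then (1 : ℤ) else 0) with hcdef
  have hsymm : ∀ σ, c (ComplexEmbedding.conjugate σ) = c σ := by
    intro σ
    have h1 : (ComplexEmbedding.conjugate σ = σ₀) ↔ (σ = ComplexEmbedding.conjugate σ₀) := by
      constructor
      · intro h
        rw [← h]
        exact (ComplexEmbedding.involutive_conjugate K σ).symm
      · intro h
        rw [h]
        exact ComplexEmbedding.involutive_conjugate K σ₀
    have h2 : (ComplexEmbedding.conjugate σ = ComplexEmbedding.conjugate σ₀) ↔ σ = σ₀ :=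
      (ComplexEmbedding.involutive_conjugate K).injective.eq_iff
    simp only [hcdef, h1, h2]
    ring
  have h := prod_embCoords_zpow_eq_one_of_mem_hodgeGroupBaseChange_ofOrientation Λ hγ c
    (two_mul_sum_mul_deg_smul_eq_of_conjugate_symm Λ c hsymm)
  have hu : ∀ σ, embCoords K (γ 1) σ ≠ 0 :=
    embCoords_apply_one_ne_zero_of_forall_apply_eq_mul (hodgeGroupBaseChange_ofOrientation_apply ℂ Λ hγ)
  simp only [hcdef, zpow_add₀ (hu _), Finset.prod_mul_distrib, prod_zpow_ite_eq_single'] at h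
  exact h

/-- **`Hg(V^n_{(F,Π)})(ℚ) ⊆ U_F(ℚ) = {x ∈ F^× | x x̄ = 1}`** for a CM field `F`: a rational point `g = (· x)` of the Hodge group has
`σ₀(x) · σ̄₀(x) = 1` for every embedding, i.e. `N_{F/F₀}(x) = 1` read through `σ₀`. [cite: Gordon1999HodgeAVSurvey, 2.12] -/
theorem apply_one_mul_conjugate_apply_one_eq_one_of_mem_hodgeGroup_ofOrientation {g : K ≃ₗ[ℚ] K}
    (hg : g ∈ (ofOrientation Λ).hodgeGroup) (σ₀ : K →+* ℂ) :
    σ₀ (g 1) * ComplexEmbedding.conjugate σ₀ (g 1) = 1 := by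
  have h := embCoords_apply_one_mul_embCoords_apply_one_conjugate_of_mem_hodgeGroupBaseChange_ofOrientation Λ
    ((mem_hodgeGroup_iff_glBaseChange_mem ℂ (ofOrientation Λ) g).1 hg) σ₀
  simpa only [embCoords_glBaseChange_apply_one] using h

end CMField

end HodgeStructure

end Literature.AlgebraicGeometry.Motives
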